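import Literature.AlgebraicTopology.SingularHomology.SphereLikeProductCohomology
import Literature.AlgebraicTopology.SingularHomology.CohomologyOfPoint
import HarnessLib

/-!
# Fibre restrictions on `U × P` for sphere-like `P`; `H²(P; M) ≅ M`

Continuation of `SphereLikeProductCohomology` (A. Hatcher, *Algebraic Topology* (2002), §3.1
pp. 199–202). For sphere-like `P` (e.g. `ℂP¹`) and any `U`:

* `map_fibreIncl_sphereMap`: the restriction of `sphereMap (y, c) ∈ H^{i+2}(U × P)` to the fibre
  `{u} × P` is `sphereMap_{pt} (y(u), c(u))` (naturality at the inclusion of the point `u`);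
* **`eq_zero_of_forall_map_fibreIncl_eq_zero`** — a class `x ∈ H²(U × P; M)` with `s^* x = 0` for a
  slice `s` and ALL FIBRE RESTRICTIONS ZERO vanishes (its `H⁰(U)`-coordinate is a `0`-cocycle,
  detected pointwise: `singularCohomology.eq_zero_of_forall_map_const_eq_zero`);
* the classes `omegaProd m = sphereMap (0, m·1) ∈ H²(U × P; M)` (`m ∈ M`): natural in `U`, killed by
  every slice, restricting on every fibre to the class `omegaFibre m ∈ H²(P; M)`;
* **`omegaFibre_bijective` — `m ↦ omegaFibre m : M ≅ H²(P; M)`**, and `Hᵏ(P; M) = 0` for `k = 1`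
  and `k ≥ 3` (`U = pt`: `Hⁱ⁺²(P) ≅ Hⁱ⁺²(pt) ⊕ Hⁱ(pt)`).

For the trivialised projective completion `U × ℂP¹` of a complex line bundle these say: a degree-2
class is determined by its restriction along the section at infinity and its fibre restrictions
(so the local Thom classes `omegaProd 1` glue), and `H²(ℂP¹; ℤ) = ℤ·ω`. Everything is proved;
no named facts.

## References

* A. Hatcher, *Algebraic Topology*, CUP 2002, §3.1 pp. 199–202. [HatcherAT2002]
-/

noncomputable section

open CategoryTheory Set

universe u v

namespace Literature.AlgebraicTopology.SingularHomology

variable {U U' : Type u} {Y : Type u} [TopologicalSpace U] [TopologicalSpace U'] [TopologicalSpace Y]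
variable (R : Type v) [CommRing R] (M : Type v) [AddCommGroup M] [Module R M]

/-! ### Degree-zero classes are detected by points; constant classes -/

omit [TopologicalSpace U'] in
/-- A singular `0`-simplex is the image of the `0`-simplex of the point under the constant map to
its point. [folklore] -/
theorem SingularSimplex.map_const_ofPoint_eq (σ : SingularSimplex U 0) :
    (SingularSimplex.ofPoint PUnit.unit).map (ContinuousMap.const PUnit.{u + 1} (SingularSimplex.pt σ)) = σ := by
  apply SingularSimplex.toContinuousMap_injective
  rw [SingularSimplex.toContinuousMap_map]
  ext t
  change SingularSimplex.pt σ = SingularSimplex.toContinuousMap σ t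
  rw [SingularSimplex.pt, StdSimplex.eq_zero_dim default t]

/-- **A class of `H⁰(U; M)` whose restriction to every point vanishes is zero** (a `0`-cocycle is a
function on the `0`-simplices, i.e. on points, and there are no coboundaries in degree `0`).
[cite: HatcherAT2002, §3.1 p. 199] -/
theorem singularCohomology.eq_zero_of_forall_map_const_eq_zero (c : singularCohomology R M U 0)
    (h : ∀ u : U, singularCohomology.map R M (ContinuousMap.const PUnit.{u + 1} u) 0 c = 0) : c = 0 := by
  obtain ⟨φ, hφ, rfl⟩ := homologyCls_surjective (K := singularCochainComplex R M U) c
  have hp : (ComplexShape.up ℕ).prev 0 = 0 := CochainComplex.prev_nat_zero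
  have hd0 : ∀ (Z : Type u) [TopologicalSpace Z],
      (singularCochainComplex R M Z).d ((ComplexShape.up ℕ).prev 0) 0 = 0 := fun Z _ =>
    (singularCochainComplex R M Z).shape _ _ (by rw [hp]; simp)
  change @Eq ((singularCochainComplex R M U).homology 0) (homologyCls φ hφ) 0
  rw [homologyCls_eq_zero_iff]
  refine ⟨0, ?_⟩
  rw [map_zero]
  refine (funext fun σ => ?_).symm
  have hσ := h (SingularSimplex.pt σ)
  change @Eq ((singularCochainComplex R M PUnit.{u + 1}).homology 0)
    (HomologicalComplex.homologyMap (singularCochainComplex.map R M (ContinuousMap.const PUnit.{u + 1} (SingularSimplex.pt σ))) 0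
      (homologyCls φ hφ)) 0 at hσ
  rw [homologyMap_homologyCls, homologyCls_eq_zero_iff] at hσ
  obtain ⟨w, hw⟩ := hσ
  have key : φ σ = (singularCochainComplex.map R M (ContinuousMap.const PUnit.{u + 1} (SingularSimplex.pt σ))).f 0 φ
      (SingularSimplex.ofPoint PUnit.unit) := by
    rw [singularCochainComplex.map_apply, SingularSimplex.map_const_ofPoint_eq]
  rw [key, ← hw, hd0]
  rfl

/-- The constant `0`-cochain with value `m`. [folklore] -/
abbrev constCochain (X : Type u) [TopologicalSpace X] (m : M) : (singularCochainComplex R M X).X 0 :=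
  fun _ : SingularSimplex X 0 => m

/-- The constant `0`-cochain is a cocycle. [cite: HatcherAT2002, §3.1 p. 199] -/
theorem d_constCochain (X : Type u) [TopologicalSpace X] (m : M) :
    (singularCochainComplex R M X).d 0 ((ComplexShape.up ℕ).next 0) (constCochain R M X m) = 0 := by
  rw [CochainComplex.next]
  exact singularCochainComplex.d_const_eq_zero m

/-- `(m + m')·const = m·const + m'·const`. [folklore] -/
theorem constCochain_add (X : Type u) [TopologicalSpace X] (m m' : M) :
    constCochain R M X (m + m') = constCochain R M X m + constCochain R M X m' := rfl

/-- `(r • m)·const = r • (m·const)`. [folklore] -/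
theorem constCochain_smul (X : Type u) [TopologicalSpace X] (r : R) (m : M) :
    constCochain R M X (r • m) = r • constCochain R M X m := rfl

variable {R} in
/-- **The constant class `m·1 ∈ H⁰(X; M)`** (class of the constant `0`-cocycle). [cite: HatcherAT2002, §3.1 p. 199] -/
def constClass (X : Type u) [TopologicalSpace X] (m : M) : singularCohomology R M X 0 :=
  homologyCls (K := singularCochainComplex R M X) (constCochain R M X m) (d_constCochain R M X m)

omit [TopologicalSpace U'] in
/-- Constant classes pull back to constant classes. [folklore] -/
theorem map_constClass {X : Type u} [TopologicalSpace X] (f : C(X, U)) (m : M) :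
    singularCohomology.map R M f 0 (constClass M U m) = constClass M X m := by
  rw [constClass, singularCohomology.map]
  erw [homologyMap_homologyCls]
  rfl

/-- `m ↦ m·1` is additive. [folklore] -/
theorem constClass_add (X : Type u) [TopologicalSpace X] (m m' : M) :
    constClass (R := R) M X (m + m') = constClass M X m + constClass M X m' := by
  exact homologyCls_add (K := singularCochainComplex R M X) (constCochain R M X m) (constCochain R M X m')
    (d_constCochain R M X m) (d_constCochain R M X m') (d_constCochain R M X (m + m'))

/-- `m ↦ m·1` is `R`-linear. [folklore] -/
theorem constClass_smul (X : Type u) [TopologicalSpace X] (r : R) (m : M) :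
    constClass (R := R) M X (r • m) = r • constClass M X m := by
  exact homologyCls_smul (K := singularCochainComplex R M X) r (constCochain R M X m) (d_constCochain R M X m)
    (d_constCochain R M X (r • m))

/-- `m·1 = 0` in `H⁰(X; M)` forces `m = 0` as soon as `X` is nonempty. [folklore] -/
theorem constClass_eq_zero_iff (X : Type u) [TopologicalSpace X] [Nonempty X] (m : M) :
    constClass (R := R) M X m = 0 ↔ m = 0 := by
  refine ⟨fun h => ?_, fun h => ?_⟩
  swap
  · subst h
    exact homologyCls_zero (K := singularCochainComplex R M X) (i := 0) _
  have hp : (ComplexShape.up ℕ).prev 0 = 0 := CochainComplex.prev_nat_zero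
  rw [constClass] at h
  change @Eq ((singularCochainComplex R M X).homology 0) (homologyCls _ _) 0 at h
  rw [homologyCls_eq_zero_iff] at h
  obtain ⟨w, hw⟩ := h
  rw [(singularCochainComplex R M X).shape _ _ (by rw [hp]; simp)] at hw
  exact (congrFun hw (SingularSimplex.ofPoint (Classical.arbitrary X))).symm

/-- **Every class of `H⁰(pt; M)` is constant.** [cite: HatcherAT2002, §3.1 p. 199] -/
theorem exists_eq_constClass_punit (c : singularCohomology R M PUnit.{u + 1} 0) : ∃ m : M, c = constClass M _ m := by
  obtain ⟨φ, hφ, rfl⟩ := homologyCls_surjective (K := singularCochainComplex R M PUnit.{u + 1}) c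
  haveI := SingularSimplex.subsingleton_of_subsingleton (X := PUnit.{u + 1}) 0
  refine ⟨φ (SingularSimplex.ofPoint PUnit.unit), homologyCls_congr (funext fun σ => ?_) _ _⟩
  rw [Subsingleton.elim σ (SingularSimplex.ofPoint PUnit.unit)]

/-! ### Fibre inclusions -/

/-- The inclusion of the fibre over `u`: `y ↦ (u, y)`. [folklore] -/
abbrev fibreIncl (u : U) : C(Y, U × Y) := (ContinuousMap.const Y u).prodMk (ContinuousMap.id Y)

omit [TopologicalSpace U'] in
/-- `y ↦ (u, y)` is `(const u × 𝟙) ∘ (y ↦ (⋆, y))`. [folklore] -/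
theorem fibreIncl_eq_comp (u : U) :
    fibreIncl (Y := Y) u =
      (prodMapId (ContinuousMap.const PUnit.{u + 1} u)).comp
        ((Homeomorph.punitProd Y).symm : C(Y, PUnit.{u + 1} × Y)) :=
  rfl

omit [TopologicalSpace U'] in
/-- A slice followed by `pr₁`... : `pr₁ ∘ fibreIncl u = const u`. [folklore] -/
theorem fst_comp_fibreIncl (u : U) :
    (ContinuousMap.fst : C(U × Y, U)).comp (fibreIncl u) = ContinuousMap.const Y u := rfl

namespace IsSphereLike

variable {A₁ A₂ : Set Y} {W₁ W₂ Vp Vm : Set ↥(A₁ ∩ A₂)} (hY : IsSphereLike Y A₁ A₂ W₁ W₂ Vp Vm)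
include hY

/-- **Fibre restriction of `sphereMap`**: `(fibreIncl u)^* sphereMap_U (y, c) =
(⋆ × 𝟙)^* sphereMap_{pt} (y|_u, c|_u)`. [cite: HatcherAT2002, §3.1 p. 200] -/
theorem map_fibreIncl_sphereMap (u : U) (i : ℕ) (y : singularCohomology R M U (i + 2))
    (c : singularCohomology R M U i) :
    singularCohomology.map R M (fibreIncl u) (i + 2) ((hY.sphereMap R M (U := U) i) (y, c)) =
      singularCohomology.map R M ((Homeomorph.punitProd Y).symm : C(Y, PUnit.{u + 1} × Y)) (i + 2)
        ((hY.sphereMap R M (U := PUnit.{u + 1}) i)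
          (singularCohomology.map R M (ContinuousMap.const PUnit.{u + 1} u) (i + 2) y,
            singularCohomology.map R M (ContinuousMap.const PUnit.{u + 1} u) i c)) := by
  rw [fibreIncl_eq_comp, singularCohomology.map_comp, ModuleCat.comp_apply, hY.map_prodMapId_sphereMap R M]

/-- **A degree-two class with zero slice and zero fibre restrictions vanishes** (sphere-like fibre):
`x = sphereMap (s^* x, c)` with `c ∈ H⁰(U)` detected by its restrictions to points, which are the
fibre restrictions of `x`. [cite: HatcherAT2002, §3.1 pp. 199–202] -/
theorem eq_zero_of_forall_map_fibreIncl_eq_zero {y₁ : Y} (hy₁ : y₁ ∈ A₁) (x : singularCohomology R M (U × Y) 2)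
    (hs : singularCohomology.map R M (sliceAt (U := U) y₁) 2 x = 0)
    (hf : ∀ u : U, singularCohomology.map R M (fibreIncl u) 2 x = 0) : x = 0 := by
  obtain ⟨⟨y, c⟩, rfl⟩ := hY.sphereMap_surjective R M (U := U) 0 x
  rw [hY.map_sliceAt_sphereMap R M hy₁] at hs
  subst hs
  suffices hc : c = 0 by rw [hc, hY.sphereMap_apply R M, map_zero, map_zero, zero_add]
  refine singularCohomology.eq_zero_of_forall_map_const_eq_zero R M c fun u => ?_
  have hu := hf u
  rw [hY.map_fibreIncl_sphereMap R M, map_zero] at hu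
  have hinj : Function.Injective
      (singularCohomology.map R M ((Homeomorph.punitProd Y).symm : C(Y, PUnit.{u + 1} × Y)) (0 + 2)) :=
    (singularCohomology.mapIso R M (Homeomorph.punitProd Y).symm (0 + 2)).toLinearEquiv.injective
  have h0 : (hY.sphereMap R M (U := PUnit.{u + 1}) 0)
      (0, singularCohomology.map R M (ContinuousMap.const PUnit.{u + 1} u) 0 c) = (hY.sphereMap R M 0) (0, 0) := by
    rw [Prod.mk_zero_zero, map_zero]
    exact hinj (hu.trans (map_zero _).symm)
  exact (Prod.ext_iff.1 (hY.sphereMap_injective R M 0 h0)).2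

/-! ### The classes `ω` -/

/-- **`ω_U(m) = sphereMap (0, m·1) ∈ H²(U × Y; M)`.** [cite: HatcherAT2002, §3.1 pp. 200–202] -/
def omegaProd (U : Type u) [TopologicalSpace U] (m : M) : singularCohomology R M (U × Y) 2 :=
  (hY.sphereMap R M (U := U) 0) (0, constClass M U m)

/-- **`ω(m) ∈ H²(Y; M)`**: `ω_{pt}(m)` transported along `Y ≅ pt × Y`. [cite: HatcherAT2002, §3.1 pp. 200–202] -/
def omegaFibre (m : M) : singularCohomology R M Y 2 :=
  singularCohomology.map R M ((Homeomorph.punitProd Y).symm : C(Y, PUnit.{u + 1} × Y)) 2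
    (hY.omegaProd R M PUnit.{u + 1} m)

/-- `ω_U(m)` is natural in `U`. [folklore] -/
theorem map_prodMapId_omegaProd (g : C(U', U)) (m : M) :
    singularCohomology.map R M (prodMapId g) 2 (hY.omegaProd R M U m) = hY.omegaProd R M U' m := by
  rw [omegaProd, hY.map_prodMapId_sphereMap R M, map_zero, map_constClass]
  rfl

/-- Every slice kills `ω_U(m)`. [folklore] -/
theorem map_sliceAt_omegaProd {y₁ : Y} (hy₁ : y₁ ∈ A₁) (m : M) :
    singularCohomology.map R M (sliceAt (U := U) y₁) 2 (hY.omegaProd R M U m) = 0 :=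
  hY.map_sliceAt_sphereMap R M hy₁ 0 0 _

/-- **`ω_U(m)` restricts to `ω(m)` on every fibre.** [cite: HatcherAT2002, §3.1 p. 200] -/
theorem map_fibreIncl_omegaProd (u : U) (m : M) :
    singularCohomology.map R M (fibreIncl u) 2 (hY.omegaProd R M U m) = hY.omegaFibre R M m := by
  rw [omegaProd, hY.map_fibreIncl_sphereMap R M, map_zero, map_constClass]
  rfl

/-- `m ↦ ω_U(m)` is additive. [folklore] -/
theorem omegaProd_add (m m' : M) : hY.omegaProd R M U (m + m') = hY.omegaProd R M U m + hY.omegaProd R M U m' := by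
  rw [omegaProd, omegaProd, omegaProd, constClass_add, ← map_add, Prod.mk_add_mk, add_zero]

/-- `m ↦ ω_U(m)` is `R`-linear. [folklore] -/
theorem omegaProd_smul (r : R) (m : M) : hY.omegaProd R M U (r • m) = r • hY.omegaProd R M U m := by
  rw [omegaProd, omegaProd, constClass_smul, ← map_smul, Prod.smul_mk, smul_zero]

/-- `ω_U(m) = 0 ↔ m = 0` for nonempty `U`. [folklore] -/
theorem omegaProd_eq_zero_iff [Nonempty U] (m : M) : hY.omegaProd R M U m = 0 ↔ m = 0 := by
  rw [← constClass_eq_zero_iff (R := R) M U m]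
  constructor
  · intro h
    have h' : (hY.sphereMap R M (U := U) 0) (0, constClass M U m) = (hY.sphereMap R M (U := U) 0) (0, 0) := by
      rw [Prod.mk_zero_zero, map_zero]
      exact h
    exact (Prod.ext_iff.1 (hY.sphereMap_injective R M 0 h')).2
  · intro h
    rw [omegaProd, h, Prod.mk_zero_zero, map_zero]

/-- `m ↦ ω(m)` is additive. [folklore] -/
theorem omegaFibre_add (m m' : M) : hY.omegaFibre R M (m + m') = hY.omegaFibre R M m + hY.omegaFibre R M m' := by
  rw [omegaFibre, omegaFibre, omegaFibre, hY.omegaProd_add R M, map_add]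

/-- `m ↦ ω(m)` is `R`-linear. [folklore] -/
theorem omegaFibre_smul (r : R) (m : M) : hY.omegaFibre R M (r • m) = r • hY.omegaFibre R M m := by
  rw [omegaFibre, omegaFibre, hY.omegaProd_smul R M, map_smul]

/-- **`ω(m) = 0 ↔ m = 0`.** [cite: HatcherAT2002, §3.1 pp. 199–202] -/
theorem omegaFibre_eq_zero_iff (m : M) : hY.omegaFibre R M m = 0 ↔ m = 0 := by
  rw [← hY.omegaProd_eq_zero_iff R M (U := PUnit.{u + 1}) m, omegaFibre]
  exact (singularCohomology.mapIso R M (Homeomorph.punitProd Y).symm 2).toLinearEquiv.injective.eq_iff' (map_zero _)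

omit hY in
/-- Elements of a zero object of `ModuleCat` vanish. [folklore] -/
private theorem eq_zero_of_isZero {X : ModuleCat.{max u v} R} (h : Limits.IsZero X) (x : X) : x = 0 := by
  have := congrArg (fun f : X ⟶ X => f x) (h.eq_of_src (𝟙 X) 0)
  simpa using this

omit hY in
/-- `z = (Y ≅ pt × Y)^* ((pt × Y → Y)^* z)`. [folklore] -/
private theorem eq_map_symm_map (k : ℕ) (z : singularCohomology R M Y k) :
    z = singularCohomology.map R M ((Homeomorph.punitProd Y).symm : C(Y, PUnit.{u + 1} × Y)) k
      (singularCohomology.map R M (Homeomorph.punitProd Y : C(PUnit.{u + 1} × Y, Y)) k z) := by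
  rw [← ModuleCat.comp_apply, ← singularCohomology.map_comp, Homeomorph.toContinuousMap_comp_symm,
    singularCohomology.map_id]
  rfl

/-- **Every class of `H²(Y; M)` is `ω(m)`** (`H²(pt × Y) = sphereMap (H²(pt) × H⁰(pt))`, `H²(pt) = 0`,
`H⁰(pt) = M·1`). [cite: HatcherAT2002, §3.1 pp. 199–202] -/
theorem exists_eq_omegaFibre (z : singularCohomology R M Y 2) : ∃ m : M, z = hY.omegaFibre R M m := by
  obtain ⟨⟨y, c⟩, hyc⟩ := hY.sphereMap_surjective R M (U := PUnit.{u + 1}) 0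
    (singularCohomology.map R M (Homeomorph.punitProd Y : C(PUnit.{u + 1} × Y, Y)) 2 z)
  have hy : y = 0 := eq_zero_of_isZero R
    (singularCochainComplex.isZero_singularCohomology_of_subsingleton' (R := R) (M := M) (X := PUnit.{u + 1})
      two_ne_zero) y
  obtain ⟨m, hm⟩ := exists_eq_constClass_punit R M c
  refine ⟨m, ?_⟩
  rw [eq_map_symm_map R M 2 z, ← hyc, hy, hm]
  rfl

/-- **`m ↦ ω(m) : M → H²(Y; M)` is bijective** for sphere-like `Y`. [cite: HatcherAT2002, §3.1 pp. 199–202] -/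
theorem omegaFibre_bijective : Function.Bijective (hY.omegaFibre R M) := by
  refine ⟨fun m m' h => ?_, fun z => ?_⟩
  · rw [← sub_eq_zero, ← hY.omegaFibre_eq_zero_iff R M, ← sub_eq_zero.2 h, eq_comm, sub_eq_iff_eq_add,
      ← hY.omegaFibre_add R M, sub_add_cancel]
  · obtain ⟨m, hm⟩ := hY.exists_eq_omegaFibre R M z
    exact ⟨m, hm.symm⟩

/-- **`H¹(Y; M) = 0`** for sphere-like `Y` (`H¹(pt × Y) = pr₁^* H¹(pt) = 0`). [cite: HatcherAT2002, §3.1 pp. 199–202] -/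
theorem eq_zero_of_degree_one (z : singularCohomology R M Y 1) : z = 0 := by
  obtain ⟨y, hy⟩ := (hY.map_fst_bijective_one R M (U := PUnit.{u + 1})).2
    (singularCohomology.map R M (Homeomorph.punitProd Y : C(PUnit.{u + 1} × Y, Y)) 1 z)
  have hy0 : y = 0 := eq_zero_of_isZero R
    (singularCochainComplex.isZero_singularCohomology_of_subsingleton' (R := R) (M := M) (X := PUnit.{u + 1})
      one_ne_zero) y
  rw [eq_map_symm_map R M 1 z, ← hy, hy0, map_zero, map_zero]

/-- **`Hᵏ(Y; M) = 0` for `k ≥ 3`** and sphere-like `Y` (`Hⁱ⁺³(pt × Y) ≅ Hⁱ⁺³(pt) ⊕ Hⁱ⁺¹(pt) = 0`).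
[cite: HatcherAT2002, §3.1 pp. 199–202] -/
theorem eq_zero_of_three_le {k : ℕ} (hk : 3 ≤ k) (z : singularCohomology R M Y k) : z = 0 := by
  obtain ⟨i, rfl⟩ : ∃ i, k = i + 1 + 2 := ⟨k - 3, by omega⟩
  obtain ⟨⟨y, c⟩, hyc⟩ := hY.sphereMap_surjective R M (U := PUnit.{u + 1}) (i + 1)
    (singularCohomology.map R M (Homeomorph.punitProd Y : C(PUnit.{u + 1} × Y, Y)) (i + 1 + 2) z)
  have hy : y = 0 := eq_zero_of_isZero R
    (singularCochainComplex.isZero_singularCohomology_of_subsingleton' (R := R) (M := M) (X := PUnit.{u + 1})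
      (Nat.succ_ne_zero _)) y
  have hc : c = 0 := eq_zero_of_isZero R
    (singularCochainComplex.isZero_singularCohomology_of_subsingleton' (R := R) (M := M) (X := PUnit.{u + 1})
      (Nat.succ_ne_zero _)) c
  rw [eq_map_symm_map R M _ z, ← hyc, hy, hc, Prod.mk_zero_zero, map_zero, map_zero]

end IsSphereLike

end Literature.AlgebraicTopology.SingularHomology
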